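import Mathlib
import Summits.CriticalPhenomena.CardyFormulaZ2.Theorems.CardyFlipRussoSquareFromVoronoiHubDefs
import Literature.Probability.RandomPlanarGeometry.ConformalRectangleProofs
import Literature.Probability.RandomPlanarGeometry.CardyFunction

/-!
# Stub `stub_faithful` (K1), line `Sketch` of crux `SquareFromVoronoiHub` — Part 3:
# the squeeze — K1 from sandwich inclusions with perturbed conformal rectangles

Crux `Summit.CriticalPhenomena.CardyFormulaZ2.Theses.CardyFlipRusso.SquareFromVoronoiHub`
(stmt-CriticalPhenomena-6434), line `Sketch` (card `voronoi-blocks-on-fixed-gs`), stub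
`stub_faithful` (registered sub-goal `stub_faithful_part3`; "faithful discretisation at cell scale `δ^{1/4}`": under Cardy's formula for
annealed Poisson–Voronoi percolation, `blockCrossingProb PB PW R δ (δ^{1/4}) -
voronoiCrossingProb PB PW R (δ^{1/4}) → 0` as `δ → 0⁺`, for every conformal rectangle `R`).

This file is the SOFT ASSEMBLY step (2) of that stub ("boundary layer via the hypothesis, not via
RSW"): it reduces K1, for a given Poisson pair and conformal rectangle `R`, to a **sandwich** — for
every `θ > 0`, a lower and an upper comparison sequence converging to values within `θ` of the
Cardy value of `R` and squeezing `blockCrossingProb R δ (δ^{1/4})` up to `θ`, eventually as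
`δ → 0⁺` (`tendsto_sub_of_squeeze`, pure real analysis).  Two instances are spelled out, the
comparison sequences being supplied by the hypothesis `VoronoiCardy` on perturbed rectangles:

* black/black (`tendsto_block_sub_voronoi_of_sandwich`): `vor_{R₁}(δ^{1/4}) - θ ≤ block_R(δ, δ^{1/4})
  ≤ vor_{R₂}(δ^{1/4}) + θ` with `R₁` harder, `R₂` easier than the crude lattice event of `R`;
* black/dual-white (`tendsto_block_sub_voronoi_of_dual_sandwich`): the upper bound in the form the
  lattice duality of the triangulation `G_s` delivers it, `block_R ≤ 1 - vor^{white}_{R₂}(δ^{1/4}) + θ`,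
  where `vor^{white} = voronoiCrossingProb PW PB` (colours swapped — the hypothesis quantifies over
  all Poisson pairs) and `R₂` has Cardy value within `θ` of `1 - F(η_R) = F(1 - η_R)` (the
  conjugate rectangle `(Ω; b, c, d, a)` up to perturbation);

and `faithful_of_sandwich`, `faithful_of_dual_sandwich` restate them in the exact shape of the
registered stub.  (Bollobás–Riordan, *Percolation* (2006), Ch. 7, (19) with Lemma 14: the same
limsup/liminf squeeze between inner and outer approximating marked domains, there for `𝕋`.)

What the sandwich needs (Parts 1–2 give its deterministic lattice half; the rest is open here):
the perturbed rectangles (exterior caps beyond `(ab)`, `(cd)`, collars off `(bc)`, `(da)`;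
continuity of the cross-ratio under the perturbation) and the probabilistic inclusions outside an
event of probability `o(1)` (no sub-mesh Voronoi defects in the window).
-/

noncomputable section

namespace Summit.CriticalPhenomena.CardyFormulaZ2.Cruxes.SquareFromVoronoiHub.VoronoiBlocks.Faithful

open scoped Topology
open Set Filter MeasureTheory
open UpperHalfPlane (upperHalfPlaneSet)
open Literature.Analysis.FunctionSpaces (PointConfig IsPoissonPointProcess)
open Literature.Probability.RandomPlanarGeometry (ConformalRectangle ConformalEquiv cardyFunction
  crossRatio)

/-! ### The squeeze (real analysis) -/

/-- **Squeeze for a difference.**  If `g → L` along `l`, and for every `θ > 0` there are sequences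
`g₁ → ℓ₁`, `g₂ → ℓ₂` with `|ℓᵢ - L| ≤ θ` and eventually `g₁ - θ ≤ f ≤ g₂ + θ`, then `f - g → 0`
along `l` (eventually `|f - g| < 4θ`). [folklore] -/
theorem tendsto_sub_of_squeeze {α : Type*} {l : Filter α} {f g : α → ℝ} {L : ℝ}
    (hg : Tendsto g l (𝓝 L))
    (h : ∀ θ : ℝ, 0 < θ → ∃ (g₁ g₂ : α → ℝ) (ℓ₁ ℓ₂ : ℝ), Tendsto g₁ l (𝓝 ℓ₁) ∧ Tendsto g₂ l (𝓝 ℓ₂) ∧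
      |ℓ₁ - L| ≤ θ ∧ |ℓ₂ - L| ≤ θ ∧ ∀ᶠ a in l, g₁ a - θ ≤ f a ∧ f a ≤ g₂ a + θ) :
    Tendsto (fun a => f a - g a) l (𝓝 0) := by
  rw [Metric.tendsto_nhds]
  intro ε hε
  obtain ⟨g₁, g₂, ℓ₁, ℓ₂, h₁, h₂, hc₁, hc₂, hev⟩ := h (ε / 8) (by positivity)
  have h0 := Metric.tendsto_nhds.1 hg (ε / 8) (by positivity)
  have h1 := h₁.eventually (eventually_gt_nhds (show ℓ₁ - ε / 8 < ℓ₁ by linarith))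
  have h2 := h₂.eventually (eventually_lt_nhds (show ℓ₂ < ℓ₂ + ε / 8 by linarith))
  filter_upwards [h0, h1, h2, hev] with a h0 h1 h2 h3
  rw [Real.dist_eq] at h0 ⊢
  rw [abs_sub_lt_iff] at h0 ⊢
  obtain ⟨hc₁a, hc₁b⟩ := abs_sub_le_iff.1 hc₁
  obtain ⟨hc₂a, hc₂b⟩ := abs_sub_le_iff.1 hc₂
  constructor <;> linarith [h3.1, h3.2]

/-- The schedule `δ ↦ δ^{1/4}` tends to `0⁺` as `δ → 0⁺`. [folklore] -/
theorem tendsto_rpow_quarter_nhdsGT :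
    Tendsto (fun δ : ℝ => δ ^ (1 / 4 : ℝ)) (𝓝[>] 0) (𝓝[>] 0) := by
  refine tendsto_nhdsWithin_iff.2 ⟨?_, ?_⟩
  · have h : Tendsto (fun δ : ℝ => δ ^ (1 / 4 : ℝ)) (𝓝 0) (𝓝 ((0 : ℝ) ^ (1 / 4 : ℝ))) :=
      (Real.continuousAt_rpow_const 0 (1 / 4) (Or.inr (by norm_num))).tendsto
    rw [Real.zero_rpow (by norm_num)] at h
    exact h.mono_left nhdsWithin_le_nhds
  · filter_upwards [self_mem_nhdsWithin] with δ hδ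
    exact Real.rpow_pos_of_pos hδ _

/-! ### The two Voronoi sandwiches -/

/-- **The black/black squeeze.**  Assume Cardy's formula for annealed Poisson–Voronoi percolation
(the crux's hypothesis `VoronoiCardy`), a Poisson pair `PB`, `PW`, a conformal rectangle `R` with
a uniformizing datum `(φ, x)`, and the SANDWICH: for every `θ > 0`, conformal rectangles `R₁`, `R₂`
with uniformizing data whose Cardy values are within `θ` of `F(crossRatio x)` and, eventually as
`δ → 0⁺`, `vor_{R₁}(δ^{1/4}) - θ ≤ block_R(δ, δ^{1/4}) ≤ vor_{R₂}(δ^{1/4}) + θ`.  Then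
`block_R(δ, δ^{1/4}) - vor_R(δ^{1/4}) → 0`. [cite: BollobasRiordan2006, Ch. 7 Lemma 14 with (19)] -/
theorem tendsto_block_sub_voronoi_of_sandwich
    (hV : ∀ (PB PW : Measure (PointConfig ℂ)),
      IsPoissonPointProcess (volume : Measure ℂ) PB → IsPoissonPointProcess (volume : Measure ℂ) PW →
      ∀ R : ConformalRectangle, R.HasCrossingLimit (voronoiCrossingProb PB PW R) cardyFunction)
    {PB PW : Measure (PointConfig ℂ)} (hPB : IsPoissonPointProcess (volume : Measure ℂ) PB)
    (hPW : IsPoissonPointProcess (volume : Measure ℂ) PW) (R : ConformalRectangle)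
    {φ : ConformalEquiv upperHalfPlaneSet R.carrier} {x : Fin 4 → ℝ} (hx : R.IsUniformizing φ x)
    (hsand : ∀ θ : ℝ, 0 < θ → ∃ (R₁ R₂ : ConformalRectangle)
        (φ₁ : ConformalEquiv upperHalfPlaneSet R₁.carrier) (x₁ : Fin 4 → ℝ)
        (φ₂ : ConformalEquiv upperHalfPlaneSet R₂.carrier) (x₂ : Fin 4 → ℝ),
        R₁.IsUniformizing φ₁ x₁ ∧ R₂.IsUniformizing φ₂ x₂ ∧
        |cardyFunction (crossRatio x₁) - cardyFunction (crossRatio x)| ≤ θ ∧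
        |cardyFunction (crossRatio x₂) - cardyFunction (crossRatio x)| ≤ θ ∧
        ∀ᶠ δ in 𝓝[>] (0 : ℝ),
          voronoiCrossingProb PB PW R₁ (δ ^ (1 / 4 : ℝ)) - θ ≤ blockCrossingProb PB PW R δ (δ ^ (1 / 4 : ℝ)) ∧
          blockCrossingProb PB PW R δ (δ ^ (1 / 4 : ℝ)) ≤ voronoiCrossingProb PB PW R₂ (δ ^ (1 / 4 : ℝ)) + θ) :
    Tendsto (fun δ : ℝ => blockCrossingProb PB PW R δ (δ ^ (1 / 4 : ℝ)) -
        voronoiCrossingProb PB PW R (δ ^ (1 / 4 : ℝ))) (𝓝[>] 0) (𝓝 0) := by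
  refine tendsto_sub_of_squeeze ((hV PB PW hPB hPW R φ x hx).comp tendsto_rpow_quarter_nhdsGT)
    fun θ hθ => ?_
  obtain ⟨R₁, R₂, φ₁, x₁, φ₂, x₂, hx₁, hx₂, hc₁, hc₂, hev⟩ := hsand θ hθ
  exact ⟨_, _, _, _, (hV PB PW hPB hPW R₁ φ₁ x₁ hx₁).comp tendsto_rpow_quarter_nhdsGT,
    (hV PB PW hPB hPW R₂ φ₂ x₂ hx₂).comp tendsto_rpow_quarter_nhdsGT, hc₁, hc₂, hev⟩

/-- **The black/dual-white squeeze.**  As `tendsto_block_sub_voronoi_of_sandwich`, but with the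
upper bound in the form delivered by lattice duality on the triangulation `G_s` (no open crossing
`(ab) ↔ (cd)` forces a closed dual crossing `(bc) ↔ (da)`): eventually
`block_R(δ, δ^{1/4}) ≤ 1 - vor^{white}_{R₂}(δ^{1/4}) + θ`, where
`vor^{white}_{R₂} = voronoiCrossingProb PW PB R₂` is the WHITE crossing probability (colours
swapped; the hypothesis covers it since it quantifies over all Poisson pairs) of a rectangle `R₂`
whose Cardy value is within `θ` of `1 - F(crossRatio x)` (a perturbation of the conjugate
rectangle `(Ω; b, c, d, a)`, of cross-ratio `1 - η`, `F(1 - η) = 1 - F(η)`).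
[cite: BollobasRiordan2006, Ch. 7 Lemma 14 with (19)] -/
theorem tendsto_block_sub_voronoi_of_dual_sandwich
    (hV : ∀ (PB PW : Measure (PointConfig ℂ)),
      IsPoissonPointProcess (volume : Measure ℂ) PB → IsPoissonPointProcess (volume : Measure ℂ) PW →
      ∀ R : ConformalRectangle, R.HasCrossingLimit (voronoiCrossingProb PB PW R) cardyFunction)
    {PB PW : Measure (PointConfig ℂ)} (hPB : IsPoissonPointProcess (volume : Measure ℂ) PB)
    (hPW : IsPoissonPointProcess (volume : Measure ℂ) PW) (R : ConformalRectangle)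
    {φ : ConformalEquiv upperHalfPlaneSet R.carrier} {x : Fin 4 → ℝ} (hx : R.IsUniformizing φ x)
    (hsand : ∀ θ : ℝ, 0 < θ → ∃ (R₁ R₂ : ConformalRectangle)
        (φ₁ : ConformalEquiv upperHalfPlaneSet R₁.carrier) (x₁ : Fin 4 → ℝ)
        (φ₂ : ConformalEquiv upperHalfPlaneSet R₂.carrier) (x₂ : Fin 4 → ℝ),
        R₁.IsUniformizing φ₁ x₁ ∧ R₂.IsUniformizing φ₂ x₂ ∧
        |cardyFunction (crossRatio x₁) - cardyFunction (crossRatio x)| ≤ θ ∧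
        |(1 - cardyFunction (crossRatio x₂)) - cardyFunction (crossRatio x)| ≤ θ ∧
        ∀ᶠ δ in 𝓝[>] (0 : ℝ),
          voronoiCrossingProb PB PW R₁ (δ ^ (1 / 4 : ℝ)) - θ ≤ blockCrossingProb PB PW R δ (δ ^ (1 / 4 : ℝ)) ∧
          blockCrossingProb PB PW R δ (δ ^ (1 / 4 : ℝ)) ≤
            1 - voronoiCrossingProb PW PB R₂ (δ ^ (1 / 4 : ℝ)) + θ) :
    Tendsto (fun δ : ℝ => blockCrossingProb PB PW R δ (δ ^ (1 / 4 : ℝ)) -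
        voronoiCrossingProb PB PW R (δ ^ (1 / 4 : ℝ))) (𝓝[>] 0) (𝓝 0) := by
  refine tendsto_sub_of_squeeze ((hV PB PW hPB hPW R φ x hx).comp tendsto_rpow_quarter_nhdsGT)
    fun θ hθ => ?_
  obtain ⟨R₁, R₂, φ₁, x₁, φ₂, x₂, hx₁, hx₂, hc₁, hc₂, hev⟩ := hsand θ hθ
  refine ⟨_, fun δ => 1 - voronoiCrossingProb PW PB R₂ (δ ^ (1 / 4 : ℝ)), _, _,
    (hV PB PW hPB hPW R₁ φ₁ x₁ hx₁).comp tendsto_rpow_quarter_nhdsGT,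
    tendsto_const_nhds.sub ((hV PW PB hPW hPB R₂ φ₂ x₂ hx₂).comp tendsto_rpow_quarter_nhdsGT),
    hc₁, hc₂, hev⟩

/-! ### The registered shape -/

/-- **K1 from the black/black sandwich, in the registered shape.**  If every Poisson pair and every
conformal rectangle admit the sandwich of `tendsto_block_sub_voronoi_of_sandwich` (Cardy-value
closeness being asked against EVERY uniformizing datum of `R`; data exist by
`MarkedDomain.exists_isUniformizing_holds`, all with the same cross-ratio by
`ConformalRectangle.crossRatio_eq_of_isUniformizing_holds`), then the stub `stub_faithful` holds:
`VoronoiCardy → ∀ PB PW Poisson, ∀ R, block_R(δ, δ^{1/4}) - vor_R(δ^{1/4}) → 0`.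
[cite: BollobasRiordan2006, Ch. 7 Lemma 14 with (19)] -/
theorem faithful_of_sandwich
    (hS : ∀ (PB PW : Measure (PointConfig ℂ)),
      IsPoissonPointProcess (volume : Measure ℂ) PB → IsPoissonPointProcess (volume : Measure ℂ) PW →
      ∀ (R : ConformalRectangle) (θ : ℝ), 0 < θ → ∃ (R₁ R₂ : ConformalRectangle)
        (φ₁ : ConformalEquiv upperHalfPlaneSet R₁.carrier) (x₁ : Fin 4 → ℝ)
        (φ₂ : ConformalEquiv upperHalfPlaneSet R₂.carrier) (x₂ : Fin 4 → ℝ),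
        R₁.IsUniformizing φ₁ x₁ ∧ R₂.IsUniformizing φ₂ x₂ ∧
        (∀ (φ : ConformalEquiv upperHalfPlaneSet R.carrier) (x : Fin 4 → ℝ), R.IsUniformizing φ x →
          |cardyFunction (crossRatio x₁) - cardyFunction (crossRatio x)| ≤ θ ∧
          |cardyFunction (crossRatio x₂) - cardyFunction (crossRatio x)| ≤ θ) ∧
        ∀ᶠ δ in 𝓝[>] (0 : ℝ),
          voronoiCrossingProb PB PW R₁ (δ ^ (1 / 4 : ℝ)) - θ ≤ blockCrossingProb PB PW R δ (δ ^ (1 / 4 : ℝ)) ∧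
          blockCrossingProb PB PW R δ (δ ^ (1 / 4 : ℝ)) ≤ voronoiCrossingProb PB PW R₂ (δ ^ (1 / 4 : ℝ)) + θ) :
    (∀ (PB PW : Measure (PointConfig ℂ)),
      IsPoissonPointProcess (volume : Measure ℂ) PB → IsPoissonPointProcess (volume : Measure ℂ) PW →
      ∀ R : ConformalRectangle, R.HasCrossingLimit (voronoiCrossingProb PB PW R) cardyFunction) →
    ∀ (PB PW : Measure (PointConfig ℂ)),
      IsPoissonPointProcess (volume : Measure ℂ) PB → IsPoissonPointProcess (volume : Measure ℂ) PW →
      ∀ R : ConformalRectangle,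
        Tendsto (fun δ : ℝ => blockCrossingProb PB PW R δ (δ ^ (1 / 4 : ℝ)) -
            voronoiCrossingProb PB PW R (δ ^ (1 / 4 : ℝ))) (𝓝[>] 0) (𝓝 0) := by
  intro hV PB PW hPB hPW R
  obtain ⟨φ, x, hx⟩ :=
    (Literature.Probability.RandomPlanarGeometry.MarkedDomain.exists_isUniformizing_holds (n := 4)) R
  refine tendsto_block_sub_voronoi_of_sandwich hV hPB hPW R hx fun θ hθ => ?_
  obtain ⟨R₁, R₂, φ₁, x₁, φ₂, x₂, hx₁, hx₂, hc, hev⟩ := hS PB PW hPB hPW R θ hθ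
  exact ⟨R₁, R₂, φ₁, x₁, φ₂, x₂, hx₁, hx₂, (hc φ x hx).1, (hc φ x hx).2, hev⟩

/-- **K1 from the black/dual-white sandwich, in the registered shape** (the form the line's
duality step produces: lower bound by a harder black Voronoi crossing, upper bound by one minus an
(almost complementary) white Voronoi crossing). [cite: BollobasRiordan2006, Ch. 7 Lemma 14 with (19)] -/
theorem faithful_of_dual_sandwich
    (hS : ∀ (PB PW : Measure (PointConfig ℂ)),
      IsPoissonPointProcess (volume : Measure ℂ) PB → IsPoissonPointProcess (volume : Measure ℂ) PW →
      ∀ (R : ConformalRectangle) (θ : ℝ), 0 < θ → ∃ (R₁ R₂ : ConformalRectangle)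
        (φ₁ : ConformalEquiv upperHalfPlaneSet R₁.carrier) (x₁ : Fin 4 → ℝ)
        (φ₂ : ConformalEquiv upperHalfPlaneSet R₂.carrier) (x₂ : Fin 4 → ℝ),
        R₁.IsUniformizing φ₁ x₁ ∧ R₂.IsUniformizing φ₂ x₂ ∧
        (∀ (φ : ConformalEquiv upperHalfPlaneSet R.carrier) (x : Fin 4 → ℝ), R.IsUniformizing φ x →
          |cardyFunction (crossRatio x₁) - cardyFunction (crossRatio x)| ≤ θ ∧
          |(1 - cardyFunction (crossRatio x₂)) - cardyFunction (crossRatio x)| ≤ θ) ∧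
        ∀ᶠ δ in 𝓝[>] (0 : ℝ),
          voronoiCrossingProb PB PW R₁ (δ ^ (1 / 4 : ℝ)) - θ ≤ blockCrossingProb PB PW R δ (δ ^ (1 / 4 : ℝ)) ∧
          blockCrossingProb PB PW R δ (δ ^ (1 / 4 : ℝ)) ≤
            1 - voronoiCrossingProb PW PB R₂ (δ ^ (1 / 4 : ℝ)) + θ) :
    (∀ (PB PW : Measure (PointConfig ℂ)),
      IsPoissonPointProcess (volume : Measure ℂ) PB → IsPoissonPointProcess (volume : Measure ℂ) PW →
      ∀ R : ConformalRectangle, R.HasCrossingLimit (voronoiCrossingProb PB PW R) cardyFunction) →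
    ∀ (PB PW : Measure (PointConfig ℂ)),
      IsPoissonPointProcess (volume : Measure ℂ) PB → IsPoissonPointProcess (volume : Measure ℂ) PW →
      ∀ R : ConformalRectangle,
        Tendsto (fun δ : ℝ => blockCrossingProb PB PW R δ (δ ^ (1 / 4 : ℝ)) -
            voronoiCrossingProb PB PW R (δ ^ (1 / 4 : ℝ))) (𝓝[>] 0) (𝓝 0) := by
  intro hV PB PW hPB hPW R
  obtain ⟨φ, x, hx⟩ :=
    (Literature.Probability.RandomPlanarGeometry.MarkedDomain.exists_isUniformizing_holds (n := 4)) R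
  refine tendsto_block_sub_voronoi_of_dual_sandwich hV hPB hPW R hx fun θ hθ => ?_
  obtain ⟨R₁, R₂, φ₁, x₁, φ₂, x₂, hx₁, hx₂, hc, hev⟩ := hS PB PW hPB hPW R θ hθ
  exact ⟨R₁, R₂, φ₁, x₁, φ₂, x₂, hx₁, hx₂, (hc φ x hx).1, (hc φ x hx).2, hev⟩

/-- **Registered sub-goal `stub_faithful_part3`** of `stub_faithful` (K1): K1 in its registered
shape from the black/dual-white sandwich with perturbed conformal rectangles (for every Poisson
pair, every conformal rectangle and every `θ > 0`), by the squeeze against the hypothesis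
`VoronoiCardy` on `R`, `R₁`, `R₂`. [cite: BollobasRiordan2006, Ch. 7 Lemma 14 with (19)] -/
theorem stub_faithful_part3 : (∀ (PB PW : Measure (PointConfig ℂ)), IsPoissonPointProcess (volume : Measure ℂ) PB → IsPoissonPointProcess (volume : Measure ℂ) PW → ∀ (R : ConformalRectangle) (θ : ℝ), 0 < θ → ∃ (R₁ R₂ : ConformalRectangle) (φ₁ : Literature.Probability.RandomPlanarGeometry.ConformalEquiv UpperHalfPlane.upperHalfPlaneSet R₁.carrier) (x₁ : Fin 4 → ℝ) (φ₂ : Literature.Probability.RandomPlanarGeometry.ConformalEquiv UpperHalfPlane.upperHalfPlaneSet R₂.carrier) (x₂ : Fin 4 → ℝ), R₁.IsUniformizing φ₁ x₁ ∧ R₂.IsUniformizing φ₂ x₂ ∧ (∀ (φ : Literature.Probability.RandomPlanarGeometry.ConformalEquiv UpperHalfPlane.upperHalfPlaneSet R.carrier) (x : Fin 4 → ℝ), R.IsUniformizing φ x → |cardyFunction (crossRatio x₁) - cardyFunction (crossRatio x)| ≤ θ ∧ |(1 - cardyFunction (crossRatio x₂)) - cardyFunction (crossRatio x)| ≤ θ)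 ∧ ∀ᶠ δ in 𝓝[>] (0 : ℝ), voronoiCrossingProb PB PW R₁ (δ ^ (1 / 4 : ℝ)) - θ ≤ blockCrossingProb PB PW R δ (δ ^ (1 / 4 : ℝ)) ∧ blockCrossingProb PB PW R δ (δ ^ (1 / 4 : ℝ)) ≤ 1 - voronoiCrossingProb PW PB R₂ (δ ^ (1 / 4 : ℝ)) + θ) → (∀ (PB PW : Measure (PointConfig ℂ)), IsPoissonPointProcess (volume : Measure ℂ) PB → IsPoissonPointProcess (volume : Measure ℂ) PW → ∀ R : ConformalRectangle, R.HasCrossingLimit (voronoiCrossingProb PB PW R) cardyFunction) → ∀ (PB PW : Measure (PointConfig ℂ)), IsPoissonPointProcess (volume : Measure ℂ) PB → IsPoissonPointProcess (volume : Measure ℂ) PW → ∀ R : ConformalRectangle, Tendsto (fun δ : ℝ => blockCrossingProb PB PW R δ (δ ^ (1 / 4 : ℝ)) - voronoiCrossingProb PB PW R (δ ^ (1 / 4 : ℝ))) (𝓝[>] 0) (𝓝 0) :=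
  fun hS => faithful_of_dual_sandwich hS

end Summit.CriticalPhenomena.CardyFormulaZ2.Cruxes.SquareFromVoronoiHub.VoronoiBlocks.Faithful

end
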